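import Summits.QuantumFields.YangMills.Theorems.BalabanUVNodesN11K1BFaceSect2FormBySupports
import Summits.QuantumFields.YangMills.Theorems.BalabanUVNodesN11ResidualPhiInert
import Literature.MathematicalPhysics.QuantumFieldTheory.Balaban1983to89.Node00.Record13SepCoPHV

/-!
# DAG node N11 ∕ key K1⁹ — THE 𝐒∕𝐓-LAWS FACTOR THROUGH (`toStage13RParams`, `Zh`); THE REST OF K1⁹'s CONSEQUENT IS RESIDUAL-BLIND; HENCE K1⁹ REDUCES, MODULO THE
# PER-HISTORY SUPPORT CONDITIONS, TO ITS RESIDUAL-BLIND REMAINDER (`Cor3_250` at a version · the non-vacuity window · the run rows (i) (iv) (C)) — plan g93 (iii) answered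
# YES in the kernel, the FLAG №15 tripwire confirmed mechanically (count-neutral, LOCATED; FLAG №15 kernel certificate #3)

HEADER — WORK-UNIT METADATA.  Cell `pub-ymgap`, YM-PLAN Track A (HUMAN RULING D-0062), seat `pub-ymgap-dag-n11-d` (g35; N11 [B14], s2), route `BalabanUVNodes`, item K1⁹ =
stmt-QuantumFields-27364 (helper lane, `--kind proof --supports 27364 --as helper`, count-neutral).  [III] = [Balaban1988Convergent], [IV] = [Balaban1989LargeFieldI], [V] =
[Balaban1989LargeFieldII].  Over this seat's `…N11K1BFaceSect2FormBySupports` (g34 H: ★★★★★★ `exists_thm1Printed_datum_by_fiat_of_supports_of_hypotheses` — FLAG №15 certificate #2,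
director-ym №293 (2)), `…N11ResidualPhiInert` (g8: `sLaw₁₃CoPH_iff_of_Phih` ∕ `tLaw₁₃CoPH_iff_of_Phih` — the smearing slot `Phih` is weightless), `…N11TopPairQuadSlotK1Hypotheses` (the
`sameR` transports), RECORD 13 v1.8 `SepCoPHV` (`Revision₁₃ = TowerRevision (towerOfRecord₁₃SepCoPH θ h)`, `datumOfRecord₁₃SepCoPHV`, `thm1Printed_datumOfRecord₁₃SepCoPHV_iff`), v1.7
`SepCoPH`∕`CoPH` (`towerOfRecord₁₃SepCoPH_ρ = densOfRecord₁₃ θ.toStage13Params`, `coreOfRecord₁₃CoPH` — only its `Sect2Form` field reads `θ` above `toStage13Params`), [V]∕[III]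
(`B16.EndStatementBPrinted = Thm1Printed ∧ Cor3_250`; `Cor3_250` reads `flow`, `χ`, `ρ`, `wilsonBG`, `numSites`).

WHY ∕ WHAT.  plan g93 (iii) (I.29246, naming n11-d ∕ RR-2): «with `quad` pinned to a constructed 𝒬_j (C2) AND the ζ0 VALUE pin inside `Provisos₁₃SepCoPH`, does §1's
`target_eq_sect2Slot_of_switch_dial` lose BOTH freedoms (ζ_k := indicator, w_k := e^{−½c}·w) — expected YES; if NO, name the third value-free slot», and the sharpened FLAG №15
TRIPWIRE «STOP-class for K1⁹ := a sorry-free theorem that, for a θ₀ … CHOSEN BY FIAT, inhabits `Cor3_250 (datumOfRecord₁₃SepCoPHV F 2 θ₀ h₀ v).C`, OR the window clause, OR any of run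
rows (i) ∕ (iv) ∕ (C)».  THE KERNEL's ANSWER.  §1 ★★ YES: the 𝐒-laws and 𝐓-laws FACTOR THROUGH the pair (`θ.toStage13RParams`, `θ.Zh`) — two `Stage13HParams` with the same
R-data and the same residual 𝐓-weight slot have the same `SLaw₁₃CoPH` ∕ `TLaw₁₃CoPH` at every run and level (`sLaw₁₃CoPH_iff_of_sameR_of_sameZh`, `tLaw₁₃CoPH_iff_of_sameR_of_sameZh`),
because the only OTHER history-indexed slot the laws read, the smearing functions `Phih` (through `rzAt`), is WEIGHTLESS (g8: (2.24)'s counterterms telescope inside (2.23),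
`wilsonLocal_add_E225`; the §2 tower reads `bgI`, `bgMS` only).  Both freedoms of the switch-and-dial are the two COMPONENTS of `Zh` (`ζ0` = the switch, `quad` = the dial); so once
VALUE rows pin both components at EVERY `(p, n, Ω, Λ, j)` — the top generation `j + 1 = n` included, which is exactly where g34's re-pins act — any two parameters of the pinned
class with the same R-data have the same laws (`sLaw₁₃CoPH_iff_of_sameR_of_valueRows` ∕ `tLaw…`): NO third dial exists, no proviso row for `Phih` is needed (`…_of_sameR_of_sameZh`
quantifies over arbitrary `Phih` on both sides).  §2 ★★ THE REST OF K1⁹'s CONSEQUENT IS RESIDUAL-BLIND: along equal `Stage13RParams` data every version `v : Revision₁₃ θ h` transports to a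
version `v′ : Revision₁₃ θ′ h′` with the SAME densities, and `Cor3_250 (datumOfRecord₁₃SepCoPHV θ′ h′ v′).C ↔ Cor3_250 (datumOfRecord₁₃SepCoPHV θ h v).C` (`Iff.rfl` after transport:
[III] Cor. 3 reads `χ_k`, `ρ_k`, the flow, the background Wilson action and `|T^{(k)}|`, never the §2 clause), the run's flow is the same (`rfl`), the β-functions of record are the
same (`betaOfRecord₁₃ θ′.toStage13Params = betaOfRecord₁₃ θ.toStage13Params`) — so the window clause and rows (i) (iv) (C) are LITERALLY unchanged (`exists_revision₁₃_of_sameR`,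
`toStage13Params_eq_of_sameR`).  Consequence for the tripwire: NO slot certificate (switch, dial, value dial, or any re-pin keeping `toStage13RParams`) can reach `Cor3_250`, the
window, or the run rows — what they say at a fiat `θ₀` is what they say at `θ`.  §3 ★★★★★★ THE REDUCTION `k1_consequent_of_residualBlind_remainder_of_supports`: from ANY `θ` in K1⁹'s
hypothesis class (`Provisos₁₃SepCoPH ∧ ZhUnity ∧ SlotsNondegenerate₁₃ ∧ Admissible`), the signs `0 ≤ E₀, B₀`, a version `v` with `Cor3_250 (datumOfRecord₁₃SepCoPHV θ h v).C`, the
non-vacuity window and the run rows (i) (iv) (C) AT `θ`, and the per-history SUPPORT conditions along the runs of some `γ`-window (a.e. on the `χ_{k+1}(s)`-support: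
`0 < ρ_{k+1}(s) → 0 < J⁰_P(s)`, `J⁰` = `θ`'s own new side, ZERO terms, top-generation residual factor `1`) FOLLOWS K1⁹'s CONSEQUENT VERBATIM (`∃ θ′ h′ v′, (ZhUnity ∧ SlotsNondegenerate₁₃) ∧
Admissible ∧ EndStatementBPrinted (datumOfRecord₁₃SepCoPHV θ′ h′ v′).C ∧ window ∧ ∃ b r γ₀ M, rows`) — `Thm1Printed` supplied BY FIAT (H), everything else TRANSPORTED (§2).  So, modulo the
support conditions, K1⁹ v10's (B)-face `Thm1Printed` conjunct is NOT an obligation of the closer: K1⁹'s genuine burden is the antecedent's inhabitation (K0), `Cor3_250` ∕ (0.1) at a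
version, the window, the run rows (i) (iv) (C), and the supports — director-ym №293 (2)(b)'s sentence, now a theorem.

HONEST FRAMING.  A REDUCTION and a READING on the tree's own rows and objects (count-neutral, LOCATED): nothing of Bałaban asserted or refuted; the support conditions are NOT
claimed at any `θ`; `Cor3_250`, the window, the run rows are HYPOTHESES here, NOT inhabited — NO K1⁹ witness is produced, K1⁹'s `∃θ` neither advanced nor refuted; no
`Stage13HParams` of record constructed or modified (anonymous-constructor transports next to an arbitrary `θ`); N11 NOT discharged; K1⁹ NOT closed; no registered stub touched;
counts unmoved (typed 28∕28 · discharged 8∕27 = 8∕28 incl. NODE O).  One finite four-torus programme at fixed `ε = L^{−K}`; NOT ℝ⁴, NOT OS, NOT a mass gap, NOT Clay.  No `sorry`,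
`axiom`, `def`, `instance`, `notation`.  Sources (SHAPE only): [V] Thm 1 p.355, (0.1) pp.355–356; [III] Thm 1 p.262, Cor. 3 (2.50) p.264, (2.17)–(2.18) p.257, (2.21)–(2.25)
pp.258–259, (3.23)–(3.25) p.270; [IV] (0.2)–(0.4) pp.176–177.
-/

noncomputable section

open MeasureTheory
open scoped BigOperators Matrix.Norms.L2Operator

namespace Summit.QuantumFields.YangMills.Theorems.BalabanUVNodesN11K1ResidualBlindReduction

open Literature.MathematicalPhysics.QuantumFieldTheory.Balaban1983to89 T4Continuum Node00 Node00.Tk B14.Eq218Concrete B14.Sect3Decomp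
open BalabanUVNodesN11ResidualPhiInert (sLaw₁₃CoPH_iff_of_Phih tLaw₁₃CoPH_iff_of_Phih)
open BalabanUVNodesN11TopPairQuadSlotK1Hypotheses (provisos₁₃SepCoPH_of_sameR slotsNondegenerate₁₃_of_sameR admissible_of_sameR)
open BalabanUVNodesN11K1BFaceSect2FormBySupports (exists_thm1Printed_datum_by_fiat_of_supports_of_hypotheses)

variable {F : T4Family} {N : ℕ} [NeZero N]

/-! ## §1. The 𝐒-laws and 𝐓-laws factor through (`toStage13RParams`, `Zh`) — plan g93 (iii): YES, no third value-free slot -/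

section Factor

/-- Equal `Stage13RParams` data give equal `Stage13Params` data (bookkeeping). [cite: Balaban1988Convergent, (2.18) p.257 (bookkeeping)] -/
theorem toStage13Params_eq_of_sameR {θ θ' : Stage13HParams F N} (hR : θ'.toStage13RParams = θ.toStage13RParams) : θ'.toStage13Params = θ.toStage13Params := by
  obtain ⟨R', Zh', Φ'⟩ := θ'
  cases hR
  rfl

omit [NeZero N] in
/-- A residual 𝐓-weight slot is determined by its two components (bookkeeping). [cite: Balaban1988Convergent, (2.21) p.258, (3.16) p.268 (bookkeeping)] -/
theorem tkResidualW_eq_of_components {V : Type} {K : ℕ} {Z Z' : TkResidualW F N V K} (hζ : Z.ζ0 = Z'.ζ0) (hq : Z.quad = Z'.quad) : Z = Z' := by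
  obtain ⟨ζ, q⟩ := Z
  obtain ⟨ζ', q'⟩ := Z'
  cases hζ
  cases hq
  rfl

/-- ★★ **THE 𝐒-LAW FACTORS THROUGH (`toStage13RParams`, `Zh`)**: two history-indexed parameters with the same R-data and the same residual 𝐓-weight slot have the same
`SLaw₁₃CoPH` at every run and level — WHATEVER their smearing slots `Phih` (weightless: g8's `sLaw₁₃CoPH_iff_of_Phih`). [cite: Balaban1988Convergent, (2.18) p.257, Thm 1 p.262, (2.23)–(2.25) pp.258–259] -/
theorem sLaw₁₃CoPH_iff_of_sameR_of_sameZh {θ₁ θ₂ : Stage13HParams F N} (hR : θ₁.toStage13RParams = θ₂.toStage13RParams) (hZ : θ₁.Zh = θ₂.Zh)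
    (p : B12.RunParams) (j : ℕ) : SLaw₁₃CoPH F N θ₁ p j ↔ SLaw₁₃CoPH F N θ₂ p j := by
  obtain ⟨R₁, Z₁, Φ₁⟩ := θ₁
  obtain ⟨R₂, Z₂, Φ₂⟩ := θ₂
  cases hR
  cases hZ
  exact sLaw₁₃CoPH_iff_of_Phih ⟨R₁, Z₁, Φ₂⟩ p Φ₁ j

/-- ★★ **THE 𝐓-LAW FACTORS THROUGH (`toStage13RParams`, `Zh`)** (same, for N11's conjunct `TLaw₁₃CoPH`). [cite: Balaban1988Convergent, remark p.262, (3.25) p.270, (2.23)–(2.25) pp.258–259] -/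
theorem tLaw₁₃CoPH_iff_of_sameR_of_sameZh {θ₁ θ₂ : Stage13HParams F N} (hR : θ₁.toStage13RParams = θ₂.toStage13RParams) (hZ : θ₁.Zh = θ₂.Zh)
    (p : B12.RunParams) (k : ℕ) : TLaw₁₃CoPH F N θ₁ p k ↔ TLaw₁₃CoPH F N θ₂ p k := by
  obtain ⟨R₁, Z₁, Φ₁⟩ := θ₁
  obtain ⟨R₂, Z₂, Φ₂⟩ := θ₂
  cases hR
  cases hZ
  exact tLaw₁₃CoPH_iff_of_Phih ⟨R₁, Z₁, Φ₂⟩ p Φ₁ k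

variable (ζv qv : (p : B12.RunParams) → ℕ → (ℕ → Set (Site (F.P p.K) 0)) → (ℕ → Set (Site (F.P p.K) 0)) → ℕ → Set (Site (F.P p.K) 0) →
  MultiCfg (F.P p.K) (SU N) (FluctV N) → ℝ)

/-- **VALUE ROWS ON BOTH COMPONENTS PIN THE SLOT**: if `θ₁` and `θ₂` both satisfy value rows `ζ0 = ζv`, `quad = qv` at EVERY run, step, pair of set-sequences, generation (the top
generation included), region and configuration, their residual 𝐓-weight slots coincide. [cite: Balaban1988Convergent, (2.21) p.258, (3.16)–(3.20) pp.268–269 (bookkeeping)] -/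
theorem zh_eq_of_valueRows {θ₁ θ₂ : Stage13HParams F N}
    (h₁ζ : ∀ p n Ω Λ j Y ω, (θ₁.Zh p n Ω Λ).ζ0 j Y ω = ζv p n Ω Λ j Y ω) (h₁q : ∀ p n Ω Λ j Λ' ω, (θ₁.Zh p n Ω Λ).quad j Λ' ω = qv p n Ω Λ j Λ' ω)
    (h₂ζ : ∀ p n Ω Λ j Y ω, (θ₂.Zh p n Ω Λ).ζ0 j Y ω = ζv p n Ω Λ j Y ω) (h₂q : ∀ p n Ω Λ j Λ' ω, (θ₂.Zh p n Ω Λ).quad j Λ' ω = qv p n Ω Λ j Λ' ω) :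
    θ₁.Zh = θ₂.Zh :=
  funext fun p => funext fun n => funext fun Ω => funext fun Λ =>
    tkResidualW_eq_of_components (funext fun j => funext fun Y => funext fun ω => (h₁ζ p n Ω Λ j Y ω).trans (h₂ζ p n Ω Λ j Y ω).symm)
      (funext fun j => funext fun Λ' => funext fun ω => (h₁q p n Ω Λ j Λ' ω).trans (h₂q p n Ω Λ j Λ' ω).symm)

/-- ★★★ **plan g93 (iii), ANSWERED YES: INSIDE A VALUE-PINNED CLASS THE SWITCH AND THE DIAL ARE GONE.**  If VALUE rows pin both components of `Zh` (C2's `quad` pin AND K0b's `ζ0`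
VALUE pin, at every generation incl. the top one), then any two parameters of the pinned class with the same `Stage13RParams` data — in particular `θ` and ANY `θ′` a re-pin «next to
`θ`» could produce — have the SAME 𝐒-laws at every run and level: the laws' right sides are determined by the R-data.  No third value-free slot exists (`Phih` is read but weightless).
[cite: Balaban1988Convergent, (2.18) p.257, (2.21) p.258, Thm 1 p.262, (3.16)–(3.20) pp.268–269] -/
theorem sLaw₁₃CoPH_iff_of_sameR_of_valueRows {θ₁ θ₂ : Stage13HParams F N} (hR : θ₁.toStage13RParams = θ₂.toStage13RParams)
    (h₁ζ : ∀ p n Ω Λ j Y ω, (θ₁.Zh p n Ω Λ).ζ0 j Y ω = ζv p n Ω Λ j Y ω) (h₁q : ∀ p n Ω Λ j Λ' ω, (θ₁.Zh p n Ω Λ).quad j Λ' ω = qv p n Ω Λ j Λ' ω)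
    (h₂ζ : ∀ p n Ω Λ j Y ω, (θ₂.Zh p n Ω Λ).ζ0 j Y ω = ζv p n Ω Λ j Y ω) (h₂q : ∀ p n Ω Λ j Λ' ω, (θ₂.Zh p n Ω Λ).quad j Λ' ω = qv p n Ω Λ j Λ' ω)
    (p : B12.RunParams) (j : ℕ) : SLaw₁₃CoPH F N θ₁ p j ↔ SLaw₁₃CoPH F N θ₂ p j :=
  sLaw₁₃CoPH_iff_of_sameR_of_sameZh hR (zh_eq_of_valueRows ζv qv h₁ζ h₁q h₂ζ h₂q) p j

/-- ★★★ … and the SAME 𝐓-laws (N11's conjunct). [cite: Balaban1988Convergent, remark p.262, (3.25) p.270, (2.21) p.258, (3.16)–(3.20) pp.268–269] -/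
theorem tLaw₁₃CoPH_iff_of_sameR_of_valueRows {θ₁ θ₂ : Stage13HParams F N} (hR : θ₁.toStage13RParams = θ₂.toStage13RParams)
    (h₁ζ : ∀ p n Ω Λ j Y ω, (θ₁.Zh p n Ω Λ).ζ0 j Y ω = ζv p n Ω Λ j Y ω) (h₁q : ∀ p n Ω Λ j Λ' ω, (θ₁.Zh p n Ω Λ).quad j Λ' ω = qv p n Ω Λ j Λ' ω)
    (h₂ζ : ∀ p n Ω Λ j Y ω, (θ₂.Zh p n Ω Λ).ζ0 j Y ω = ζv p n Ω Λ j Y ω) (h₂q : ∀ p n Ω Λ j Λ' ω, (θ₂.Zh p n Ω Λ).quad j Λ' ω = qv p n Ω Λ j Λ' ω)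
    (p : B12.RunParams) (k : ℕ) : TLaw₁₃CoPH F N θ₁ p k ↔ TLaw₁₃CoPH F N θ₂ p k :=
  tLaw₁₃CoPH_iff_of_sameR_of_sameZh hR (zh_eq_of_valueRows ζv qv h₁ζ h₁q h₂ζ h₂q) p k

end Factor

/-! ## §2. The rest of K1⁹'s consequent is residual-blind: versions transport along equal R-data; `Cor3_250`, the flow, the β-functions do not read `Zh` ∕ `Phih` -/

section Blind

/-- **[III] COR. 3 DOES NOT READ THE §2 CLAUSE** (generic, B16-level): updating the `Sect2Form` field of every run's data leaves `Cor3_250` unchanged (`Iff.rfl` — (2.50) reads `χ_k`,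
`ρ_k`, `g_k`, `A(U_k(V_k))`, `|T^{(k)}|`). [cite: Balaban1988Convergent, Cor. 3 (2.50) p.264 (bookkeeping)] -/
theorem cor3_250_update_sect2Form_iff (C : B16.Construction) (S : B12.RunParams → ℕ → Prop) :
    B16.Cor3_250 (fun P => { C P with Sect2Form := S P }) ↔ B16.Cor3_250 C := Iff.rfl

/-- ★★ **VERSIONS TRANSPORT ALONG EQUAL R-DATA; THE REVISED DATUM MOVES ONLY IN ITS §2 CLAUSE.**  For `θ′` with the same `Stage13RParams` data as `θ` (any `Zh′`, `Phih′`, any proviso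
proofs `h`, `h′`), every version `v` of the record at `θ` yields a version `v′` at `θ′` with the SAME re-chosen densities, and the revised datum's construction at (`θ′`, `v′`) IS the one
at (`θ`, `v`) with the `Sect2Form` field replaced by the record's §2 clause at `θ′` (`rfl` after transport: the tower's densities are `densOfRecord₁₃ θ.toStage13Params`, the core
`coreOfRecord₁₃CoPH` reads `θ` above `toStage13Params` only in `Sect2Form`). [cite: Balaban1988Convergent, (0.2) p.244, (2.18) p.257, Cor. 3 (2.50) p.264; Balaban1989LargeFieldII, Thm 1 + (0.1) pp.355–356 (bookkeeping)] -/
theorem exists_revision₁₃_of_sameR {θ θ' : Stage13HParams F N} (hR : θ'.toStage13RParams = θ.toStage13RParams)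
    (h : θ.Provisos₁₃SepCoPH F N) (h' : θ'.Provisos₁₃SepCoPH F N) (v : Revision₁₃ F N θ h) :
    ∃ v' : Revision₁₃ F N θ' h', v'.ρ = v.ρ ∧
      (datumOfRecord₁₃SepCoPHV F N θ' h' v').C =
        fun P => { (datumOfRecord₁₃SepCoPHV F N θ h v).C P with Sect2Form := ((datumOfRecord₁₃SepCoPH F N θ' h').C P).Sect2Form } := by
  obtain ⟨R', Zh', Φ'⟩ := θ'
  cases hR
  exact ⟨⟨v.ρ, v.rho_zero_eq, v.ae_eq_succ⟩, rfl, rfl⟩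

/-- ★★ **[III] COR. 3, THE RUN's FLOW AND [V] THM 1's READING AT A TRANSPORTED VERSION**: along equal R-data there is a version `v′` at `θ′` with the same densities at which
`Cor3_250` is EQUIVALENT to `Cor3_250` at (`θ`, `v`), the run's flow is the SAME, and `Thm1Printed` is the version-free clause of the record at `θ′` — so no re-pin keeping
`toStage13RParams` can move [III] Cor. 3 or the window clause. [cite: Balaban1988Convergent, Cor. 3 (2.50) p.264, (0.2) p.244; Balaban1989LargeFieldII, Thm 1 + (0.1) pp.355–356] -/
theorem exists_revision₁₃_cor3_iff_of_sameR {θ θ' : Stage13HParams F N} (hR : θ'.toStage13RParams = θ.toStage13RParams)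
    (h : θ.Provisos₁₃SepCoPH F N) (h' : θ'.Provisos₁₃SepCoPH F N) (v : Revision₁₃ F N θ h) :
    ∃ v' : Revision₁₃ F N θ' h', v'.ρ = v.ρ ∧
      (B16.Cor3_250 (datumOfRecord₁₃SepCoPHV F N θ' h' v').C ↔ B16.Cor3_250 (datumOfRecord₁₃SepCoPHV F N θ h v).C) ∧
      (∀ P : B12.RunParams, ((datumOfRecord₁₃SepCoPHV F N θ' h' v').C P).flow = ((datumOfRecord₁₃SepCoPHV F N θ h v).C P).flow) ∧
      (B16.Thm1Printed (datumOfRecord₁₃SepCoPHV F N θ' h' v').C ↔ B16.Thm1Printed (datumOfRecord₁₃SepCoPH F N θ' h').C) := by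
  obtain ⟨v', hρ, hC⟩ := exists_revision₁₃_of_sameR hR h h' v
  refine ⟨v', hρ, ?_, fun P => ?_, thm1Printed_datumOfRecord₁₃SepCoPHV_iff F N θ' h' v'⟩
  · rw [hC]
    exact cor3_250_update_sect2Form_iff _ _
  · rw [hC]

/-- **THE β-FUNCTIONS OF RECORD ARE RESIDUAL-BLIND**: the run rows (i) (iv) (C) of K1⁹ read `betaOfRecord₁₃ θ.toStage13Params` only. [cite: Balaban1987RG1, (1.20)–(1.22) p.264 (bookkeeping)] -/
theorem betaOfRecord₁₃_eq_of_sameR {θ θ' : Stage13HParams F N} (hR : θ'.toStage13RParams = θ.toStage13RParams) :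
    betaOfRecord₁₃ F N θ'.toStage13Params = betaOfRecord₁₃ F N θ.toStage13Params := by
  rw [toStage13Params_eq_of_sameR hR]

end Blind

/-! ## §3. THE REDUCTION: K1⁹'s consequent from its residual-blind remainder at ANY `θ` of the class, the signs and the per-history support conditions -/

section Reduction

/-- ★★★★★★ **K1⁹ REDUCES, MODULO SUPPORTS, TO ITS RESIDUAL-BLIND REMAINDER.**  Let `θ` carry K1⁹'s hypothesis-side conjuncts (`Provisos₁₃SepCoPH`, `ZhUnity`, `SlotsNondegenerate₁₃`,
`Admissible`) and the signs `0 ≤ E₀, B₀`; suppose AT `θ`: a version `v` with [III] Cor. 3 `Cor3_250 (datumOfRecord₁₃SepCoPHV θ h v).C`, the non-vacuity window, and the run rows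
(i) (run-wise constant remainder) (iv) (partial-sum floor) (C) (survivor continuity) of `betaOfRecord₁₃ θ`; and suppose the per-history SUPPORT conditions along the runs of some
`γ`-window (a.e. on the `χ_{k+1}(s)`-support: `0 < ρ_{k+1}(s)(V) → 0 < J⁰_P(s)(V)`, ZERO terms, constants `e_P`, top-generation residual factor `1`).  THEN K1⁹'s CONSEQUENT HOLDS VERBATIM:
`∃ θ′ h′ v′, (ZhUnity ∧ SlotsNondegenerate₁₃) ∧ Admissible ∧ B16.EndStatementBPrinted (datumOfRecord₁₃SepCoPHV θ′ h′ v′).C ∧ window ∧ ∃ b r γ₀ M, rows` — `Thm1Printed` BY FIAT (H), `Cor3_250`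
∕ window ∕ rows TRANSPORTED along the equal R-data (§2).  LOCATED, count-neutral: the remainder and the supports are HYPOTHESES, not inhabited; no K1⁹ witness; nothing of Bałaban
asserted or refuted. [cite: Balaban1989LargeFieldII, Thm 1 + (0.1) pp.355–356; Balaban1988Convergent, Thm 1 p.262, Cor. 3 (2.50) p.264, (2.17)–(2.18) p.257, (2.21)–(2.23) p.258, (3.23)–(3.25) p.270; Balaban1989LargeFieldI, (0.2)–(0.4) pp.176–177] -/
theorem k1_consequent_of_residualBlind_remainder_of_supports (θ : Stage13HParams F N) (hP : θ.Provisos₁₃SepCoPH F N) (hU : θ.ZhUnity)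
    (hS : θ.SlotsNondegenerate₁₃ F N) (hA : θ.Admissible F N) (hE₀ : 0 ≤ θ.s2.lf.E₀) (hB₀ : 0 ≤ θ.s2.lf.B₀) (e : B12.RunParams → ℝ)
    (v : Revision₁₃ F N θ hP) (hcor : B16.Cor3_250 (datumOfRecord₁₃SepCoPHV F N θ hP v).C)
    (hwin : ∃ γ₁ : ℝ, 0 < γ₁ ∧ ∀ γ : ℝ, 0 < γ → γ ≤ γ₁ → ∃ P : B12.RunParams, 1 ≤ P.K ∧ ((datumOfRecord₁₃SepCoPHV F N θ hP v).C P).flow.InInterval γ P.K)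
    (hrows : ∃ (b : ℕ → ℝ) (r γ₀ M : ℝ), 0 < γ₀ ∧
      (∀ (n : ℕ) (gs : ℕ → ℝ), FlowStep.RGEqH n (betaOfRecord₁₃ F N θ.toStage13Params) gs → Step.InInterval γ₀ n gs →
        ∀ k, k ≤ n → |betaOfRecord₁₃ F N θ.toStage13Params k (FlowStep.prefixOf gs k) - b k| ≤ r) ∧
      (∀ (n : ℕ) (gs : ℕ → ℝ), FlowStep.RGEqH n (betaOfRecord₁₃ F N θ.toStage13Params) gs → Step.InInterval γ₀ n gs →
        ∀ k, k ≤ n → -M ≤ ∑ j ∈ Finset.Ico k n, betaOfRecord₁₃ F N θ.toStage13Params j (FlowStep.prefixOf gs j)) ∧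
      ∀ k : ℕ, ContinuousOn (fun x : ℝ => betaOfRecord₁₃ F N θ.toStage13Params k (FlowStep.clampPrefix (betaOfRecord₁₃ F N θ.toStage13Params) γ₀ k x))
        {x : ℝ | 0 < x ∧ x ≤ γ₀ ∧ ∀ j, j ≤ k → 1 / γ₀ ^ 2 ≤ FlowStep.Y (betaOfRecord₁₃ F N θ.toStage13Params) γ₀ j x})
    (hsupp : ∃ γ : ℝ, 0 < γ ∧ ∀ P : B12.RunParams, (settingOfRecord₁₃ F N θ.toStage13Params P).flow.InInterval γ P.K → ∀ k, k < P.K →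
      ∀ s : SeqOfRecord F θ.ν θ.τ9.M (gOfRecord₁₃ F N θ.toStage13Params P) P.K (k + 1),
        ∀ᵐ V ∂fieldMeasure (F.P P.K) (k + 1) (SU N), chiSeqOfRecord F N θ.ν θ.τ9.M (gOfRecord₁₃ F N θ.toStage13Params P) P.K (k + 1) s V ≠ 0 →
          0 < slotsOfRecord F N θ.ν θ.τ9 (EOfRecord₁₃ F N θ.toStage13Params) (wOfRecord₉ F N θ.toStage9Params) θ.ppSel P (gOfRecord₁₃ F N θ.toStage13Params P) (k + 1) s V →
          0 < sect2Slot F N (FluctV N) P.K (settingOfRecord₁₃ F N θ.toStage13Params P) (θ.rzAt P s)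
            { WtOfRecord₁₃H F N θ P s with ζ := fun j Y ω => if j = k then 1 else (WtOfRecord₁₃H F N θ P s).ζ j Y ω } s Sect2.TermValues.zero (e P)
            (UbgOfRecord₁₃CoP F N θ.toStage13Params P (k + 1) s) V) :
    ∃ (θ' : Stage13HParams F N) (h' : θ'.Provisos₁₃SepCoPH F N) (v' : Revision₁₃ F N θ' h'),
      (θ'.ZhUnity ∧ θ'.SlotsNondegenerate₁₃ F N) ∧ θ'.Admissible F N ∧ B16.EndStatementBPrinted (datumOfRecord₁₃SepCoPHV F N θ' h' v').C ∧
      (∃ γ₁ : ℝ, 0 < γ₁ ∧ ∀ γ : ℝ, 0 < γ → γ ≤ γ₁ → ∃ P : B12.RunParams, 1 ≤ P.K ∧ ((datumOfRecord₁₃SepCoPHV F N θ' h' v').C P).flow.InInterval γ P.K) ∧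
      ∃ (b : ℕ → ℝ) (r γ₀ M : ℝ), 0 < γ₀ ∧
        (∀ (n : ℕ) (gs : ℕ → ℝ), FlowStep.RGEqH n (betaOfRecord₁₃ F N θ'.toStage13Params) gs → Step.InInterval γ₀ n gs →
          ∀ k, k ≤ n → |betaOfRecord₁₃ F N θ'.toStage13Params k (FlowStep.prefixOf gs k) - b k| ≤ r) ∧
        (∀ (n : ℕ) (gs : ℕ → ℝ), FlowStep.RGEqH n (betaOfRecord₁₃ F N θ'.toStage13Params) gs → Step.InInterval γ₀ n gs →
          ∀ k, k ≤ n → -M ≤ ∑ j ∈ Finset.Ico k n, betaOfRecord₁₃ F N θ'.toStage13Params j (FlowStep.prefixOf gs j)) ∧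
        ∀ k : ℕ, ContinuousOn (fun x : ℝ => betaOfRecord₁₃ F N θ'.toStage13Params k (FlowStep.clampPrefix (betaOfRecord₁₃ F N θ'.toStage13Params) γ₀ k x))
          {x : ℝ | 0 < x ∧ x ≤ γ₀ ∧ ∀ j, j ≤ k → 1 / γ₀ ^ 2 ≤ FlowStep.Y (betaOfRecord₁₃ F N θ'.toStage13Params) γ₀ j x} := by
  obtain ⟨θ', h', h1, -, hUS', hA', hthm⟩ := exists_thm1Printed_datum_by_fiat_of_supports_of_hypotheses θ hP hU hS hA e
  obtain ⟨v', -, hcorIff, hflow, hthmIff⟩ := exists_revision₁₃_cor3_iff_of_sameR h1 hP h' v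
  obtain ⟨γ, hγ, hsup⟩ := hsupp
  refine ⟨θ', h', v', hUS', hA', ⟨hthmIff.2 (hthm γ hγ hE₀ hB₀ hsup), hcorIff.2 hcor⟩, ?_, ?_⟩
  · obtain ⟨γ₁, hγ₁, hw⟩ := hwin
    refine ⟨γ₁, hγ₁, fun γ' hγ' hle => ?_⟩
    obtain ⟨P, hK, hI⟩ := hw γ' hγ' hle
    exact ⟨P, hK, by rw [hflow P]; exact hI⟩
  · rw [betaOfRecord₁₃_eq_of_sameR h1]
    exact hrows

end Reduction

end Summit.QuantumFields.YangMills.Theorems.BalabanUVNodesN11K1ResidualBlindReduction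

end
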